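import Literature.AnabelianGeometry.EtaleTheta.Discharge.Sec4Remark411
import Literature.AlgebraicGeometry.Frobenioids.ModelFrobenioidPullbacks
import Literature.AlgebraicGeometry.Frobenioids.ModelFrobenioidUnits
import HarnessLib

/-!
# [EtTh] Remark 4.1.1, second clause: the categorical-quotient property of a morphism of base-Frobenius type,
# for the model Frobenioid, REDUCED to Galois descent along its base morphism

Mochizuki, *The étale theta function …*, Publ. RIMS **45** (2009), §4, Remark 4.1.1, PDF p.88
[cite: MochizukiEtTh2009, Rmk 4.1.1 p.88]: "if `α : A → B` is of base-Frobenius type, then … one verifies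
easily that `A → B` is a categorical quotient [cf. [FrdI], §0] of `A` by the subgroup `G · μ_N(A) ⊆ Aut_C(A)` in
the full subcategory of `C` determined by the Frobenius-trivial objects".

PROOF-ONLY companion of `BiKummer.lean` (abc-iut-L2-t3: the named `Prop` `BiKummerSetting.Remark411`) and
`Discharge/Sec4Remark411.lean` (abc-iut-L6-t12: conjunct (1) `remark411_actsOver`; diagnosis that conjunct (2)
needs a property of the BASE category), abc-iut cell, block F, seat abc-iut-f-108, FACT-LIST row F-0729.
Over an arbitrary §4 setting `S` (whose Frobenioid IS the model Frobenioid `C = S.tf.category` of [FrdI] Thm. 5.2,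
`Φ` divisorial, `B` group-like) we prove, for `α : A → B` of base-Frobenius type with data `(G, α', α'')`:

* `degFr_dvd_of_mu_invariant` — a morphism `ψ : A → Y` over which `μ_N(A)` acts trivially (`N = deg_Fr(α)`, `A`
  `μ_N`-saturated) has Frobenius degree divisible by `N` (the unit `u_σ` of a generator `σ ∈ μ_N(A)` has order `N` in
  `B(A_D)` and `u_σ^{deg ψ} = 1`);
* `existsUnique_fac_of_descent` — **conjunct (2) of Remark 4.1.1 REDUCED to Galois descent along `Base(α)`**: if
  (Q) every arrow `A_D → Y_D` of `D` fixed by `Gal(A^bs/B^bs)` factors through `Base(α) : A_D → B_D` (the categorical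
  quotient in the BASE — print's input, for `D` a connected temperoid), and the `Gal(A^bs/B^bs)`-invariants of
  (Φ) `Φ(A_D)` and (B) `B(A_D)` descend INJECTIVELY along `Base(α)`, then every `ψ : A → Y` over which `G · μ_N(A)` acts
  trivially factors UNIQUELY through `α` (for every `Y`, Frobenius-trivial or not);
* `existsUnique_fac_of_isIso_baseMap` — all three descent inputs are automatic when `Base(α)` is an isomorphism, so
  conjunct (2) then holds outright; `remark411_of_forall_isIso` — hence the named fact `Remark411` HOLDS for every
  setting over a base category all of whose arrows are invertible, e.g. the one-object base of the cell's toy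
  settings (where abc-iut-w5-d063's `Toy.remark411`, `Discharge/Sec4NonVacuityRemark411.lean`, obtains it by the
  degenerate route "no `μ_N`-saturation for `N ≥ 2`"), complementing `not_forall_remark411` (span base,
  `Discharge/Sec4Remark411Schema.lean`).

Nothing is assumed beyond the displayed hypotheses; no statement of the paper is restated or strengthened (print's
`D` satisfies (Q) by [SemiAnbd] §3 / [EtTh] Prop. 3.4, and (Φ), (B) for divisors and rational functions on curves);
no new definition, no instance, no `sorry`.  HONEST FRAMING: typed ≠ proved; nothing here bears on [IUTchIII] Cor. 3.12.
-/

noncomputable section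

namespace Literature.AnabelianGeometry.EtaleTheta

open CategoryTheory Opposite Literature.AlgebraicGeometry.Frobenioids

universe u₀ v₀ u v w

variable {K : Type u₀} [Field K]

namespace BiKummerSetting

variable {X : SemiGraphs.TemperedArithmeticGroup.{u₀} K} {D₀ : Type u₀} [Category.{v₀} D₀]
  {V : FrdIMonoidStub.{w}} {T : RealifiedDivisorMonoids (D₀ := D₀) V} {D : Type u} [Category.{v} D]
  {VD : FrdICatStub.{u, v, w} D} (S : BiKummerSetting X T D VD)

namespace BaseFrobeniusTypeData

variable {S} {A B : S.C} {α : A ⟶ B}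

/-- Rearrangement in a commutative group used for the `Gal`-invariance of `u_ψ · u_α^{-d'}`. [folklore] -/
private theorem units_aux {G : Type*} [CommGroup G] (a v w : G) : a * w⁻¹ * (v * w⁻¹)⁻¹ = a * v⁻¹ := by
  rw [mul_inv, inv_inv, mul_comm v⁻¹ w, ← mul_assoc, inv_mul_cancel_right]

/-- For `α = α' ∘ α''` of base-Frobenius type: `α'` is a linear isometry (a pull-back morphism of the model
Frobenioid, [FrdI] Thm. 5.2 (ii)), `α''` a base-identity isometry; hence `Div(α) = 0`.
[cite: MochizukiEtTh2009, Def 4.1 p.87] -/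
theorem div_eq_one (d : S.BaseFrobeniusTypeData α)
    (hΦd : Objectwise (fun M _ => IsDivisorial M) S.tf.divisorMonoid) : ModelFrobenioid.div α = 1 := by
  have h₁ := ModelFrobenioid.degFr_div_of_isPullbackMorphism hΦd d.cond_d
  have h₂b : ModelFrobenioid.baseMap d.α₂ = 𝟙 _ := d.cond_c.1
  have h₂d : ModelFrobenioid.div d.α₂ = 1 := d.cond_c.2.1.2
  have h : ModelFrobenioid.div (d.α₂ ≫ d.α₁) = 1 := by
    rw [ModelFrobenioid.div_comp_pull, h₂b, pull_id, h₁.2, h₂d, one_pow, mul_one]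
  rwa [d.fac] at h

/-- `Base(α) = Base(α')` (as `Base(α'') = id`). [cite: MochizukiEtTh2009, Def 4.1 p.87] -/
theorem baseMap_eq (d : S.BaseFrobeniusTypeData α) :
    ModelFrobenioid.baseMap α = ModelFrobenioid.baseMap d.α₁ := by
  have h₂b : ModelFrobenioid.baseMap d.α₂ = 𝟙 _ := d.cond_c.1
  have h : ModelFrobenioid.baseMap (d.α₂ ≫ d.α₁) = ModelFrobenioid.baseMap d.α₁ := by
    rw [ModelFrobenioid.baseMap_comp, h₂b, Category.id_comp]
  rwa [d.fac] at h

/-- `deg_Fr(α) = deg_Fr(α'')` (as `α'` is linear). [cite: MochizukiEtTh2009, Def 4.1 p.87] -/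
theorem degFr_eq (d : S.BaseFrobeniusTypeData α)
    (hΦd : Objectwise (fun M _ => IsDivisorial M) S.tf.divisorMonoid) :
    ModelFrobenioid.degFr α = ModelFrobenioid.degFr d.α₂ := by
  have h₁ := ModelFrobenioid.degFr_div_of_isPullbackMorphism hΦd d.cond_d
  have h : ModelFrobenioid.degFr (d.α₂ ≫ d.α₁) = ModelFrobenioid.degFr d.α₂ := by
    rw [ModelFrobenioid.degFr_comp, h₁.1, one_mul]
  rwa [d.fac] at h

/-- Every element of `Gal(A^bs/B^bs)` is `Base(γ)` for some `γ ∈ G` (condition (b)).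
[cite: MochizukiEtTh2009, Def 4.1 p.87] -/
theorem exists_mem_G_of_mem_galOver (d : S.BaseFrobeniusTypeData α) {g : Aut A.base} (hg : g ∈ S.galOver α) :
    ∃ γ ∈ d.G, ModelFrobenioid.baseMap γ.hom = g.hom := by
  obtain ⟨γ, hγ, hγg⟩ := d.mapsIsomorphically.surjOn hg
  exact ⟨γ, hγ, congrArg Iso.hom hγg⟩

/-- **`N = deg_Fr(α)` divides the Frobenius degree of every `μ_N(A)`-invariant morphism `ψ : A → Y`**: a generator
`σ` of `μ_N(A) ≅ ℤ/Nℤ` (`A` is `μ_N`-saturated) has `u_σ` of order `N` in `B(A_D)` (`O^×(A) ↪ B(A_D)`, [FrdI] Thm. 5.2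
(ii)), while `ψ ∘ σ = ψ` forces `u_σ^{deg_Fr(ψ)} = 1`. [cite: MochizukiEtTh2009, Rmk 4.1.1 p.88] -/
theorem degFr_dvd_of_mu_invariant (d : S.BaseFrobeniusTypeData α)
    (hΦd : Objectwise (fun M _ => IsDivisorial M) S.tf.divisorMonoid)
    (hBg : Objectwise (fun M _ => IsGroupLike M) S.tf.ratFnFunctor) {Y : S.C} (ψ : A ⟶ Y)
    (hψ : ∀ γ ∈ d.G ⊔ Subgroup.closure (S.mu A (S.degFr α)), γ.hom ≫ ψ = ψ) :
    S.degFr α ∣ S.degFr ψ := by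
  obtain ⟨σ, hσ, hord, -⟩ := d.isMuSaturated
  have hfix : σ.hom ≫ ψ = ψ := hψ σ (Subgroup.mem_sup_right (Subgroup.subset_closure hσ))
  have hu : σ ∈ S.units A := hσ.1
  have hb : ModelFrobenioid.baseMap σ.hom = 𝟙 _ := hu.1
  -- `u_σ ^ deg(ψ) = 1` in `B(A_D)`
  haveI : IsCancelMul (S.tf.ratFnFunctor.obj (op A.base)) :=
    isIntegral_iff_isCancelMul.mp (hBg A.base).isPreDivisorial.isIntegral
  have hunit := congrArg ModelFrobenioid.unit hfix
  rw [ModelFrobenioid.unit_comp_pull, hb, pull_id] at hunit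
  have hpow : ModelFrobenioid.unit σ.hom ^ (ModelFrobenioid.degFr ψ : ℕ) = 1 :=
    mul_left_cancel (a := ModelFrobenioid.unit ψ) (by rw [hunit, mul_one])
  -- hence `σ ^ deg(ψ) = 1` in `Aut_C(A)` (`O^×(A) → B(A_D)^×` is injective, `Φ` integral)
  let σ' : ModelFrobenioid.units A := ⟨σ, hu⟩
  have hσ' : σ' ^ (ModelFrobenioid.degFr ψ : ℕ) = 1 := by
    apply ModelFrobenioid.unitsToRatFn_injective (hΦd A.base).isPreDivisorial.isIntegral
    rw [map_pow, map_one]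
    exact Units.ext (by
      rw [Units.val_pow_eq_pow_val, ModelFrobenioid.coe_unitsToRatFn, Units.val_one]; exact hpow)
  have hσpow : σ ^ (ModelFrobenioid.degFr ψ : ℕ) = 1 := by
    have := congrArg Subtype.val hσ'
    simpa using this
  have hdvd : orderOf σ ∣ (ModelFrobenioid.degFr ψ : ℕ) := orderOf_dvd_of_pow_eq_one hσpow
  rw [hord] at hdvd
  exact PNat.dvd_iff.2 hdvd

/-- **Remark 4.1.1, second clause, REDUCED to Galois descent along `Base(α)`** (model Frobenioid; `Φ` divisorial,
`B` group-like).  Inputs, for `p := Base(α) : A_D → B_D` and `Gal := Gal(A^bs/B^bs) ⊆ Aut_D(A_D)`: (Q) every arrow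
`A_D → Y_D` fixed by `Gal` factors through `p` — `p` is a categorical quotient in the BASE category (print: [EtTh]
Prop. 3.4 / [SemiAnbd] §3 for the connected temperoid `D`); (Φ) `Gal`-invariant elements of `Φ(A_D)` are pull-backs
along `p`, injectively on `Φ(A_D)^gp`; (B) the same for `B(A_D)`.  Output: every `ψ : A → Y` over which `G · μ_N(A)`
acts trivially factors uniquely through `α`. [cite: MochizukiEtTh2009, Rmk 4.1.1 p.88] -/
theorem existsUnique_fac_of_descent (d : S.BaseFrobeniusTypeData α)
    (hΦd : Objectwise (fun M _ => IsDivisorial M) S.tf.divisorMonoid)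
    (hBg : Objectwise (fun M _ => IsGroupLike M) S.tf.ratFnFunctor)
    (hQ : ∀ {Y₀ : D} (q : A.base ⟶ Y₀), (∀ g ∈ S.galOver α, g.hom ≫ q = q) →
      ∃ q' : B.base ⟶ Y₀, ModelFrobenioid.baseMap α ≫ q' = q)
    (hΦ : ∀ z : S.tf.divisorMonoid.obj (op A.base), (∀ g ∈ S.galOver α, pull S.tf.divisorMonoid g.hom z = z) →
      ∃ z' : S.tf.divisorMonoid.obj (op B.base), pull S.tf.divisorMonoid (ModelFrobenioid.baseMap α) z' = z)
    (hΦinj : Function.Injective (pullGp S.tf.divisorMonoid (ModelFrobenioid.baseMap α)))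
    (hB : ∀ t : S.tf.ratFnFunctor.obj (op A.base), (∀ g ∈ S.galOver α, pull S.tf.ratFnFunctor g.hom t = t) →
      ∃ t' : S.tf.ratFnFunctor.obj (op B.base), pull S.tf.ratFnFunctor (ModelFrobenioid.baseMap α) t' = t)
    (hBinj : Function.Injective (pull S.tf.ratFnFunctor (ModelFrobenioid.baseMap α)))
    {Y : S.C} (ψ : A ⟶ Y) (hψ : ∀ γ ∈ d.G ⊔ Subgroup.closure (S.mu A (S.degFr α)), γ.hom ≫ ψ = ψ) :
    ∃! ψ' : B ⟶ Y, α ≫ ψ' = ψ := by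
  -- notation and the shape of `α`
  have hdivα : ModelFrobenioid.div α = 1 := d.div_eq_one hΦd
  set p := ModelFrobenioid.baseMap α with hp
  set N := ModelFrobenioid.degFr α with hN
  haveI instB : ∀ Z : D, IsCancelMul (S.tf.ratFnFunctor.obj (op Z)) := fun Z =>
    isIntegral_iff_isCancelMul.mp (hBg Z).isPreDivisorial.isIntegral
  -- `deg ψ = N · d'`
  obtain ⟨d', hd'⟩ : S.degFr α ∣ S.degFr ψ := d.degFr_dvd_of_mu_invariant hΦd hBg ψ hψ
  change ModelFrobenioid.degFr ψ = N * d' at hd'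
  -- invariance of the components of `ψ` under `Gal(A^bs/B^bs)`
  have hGψ : ∀ γ ∈ d.G, γ.hom ≫ ψ = ψ := fun γ hγ => hψ γ (Subgroup.mem_sup_left hγ)
  have hGα : ∀ γ ∈ d.G, γ.hom ≫ α = α := fun γ hγ => d.G_le hγ
  have hq_inv : ∀ g ∈ S.galOver α, g.hom ≫ ModelFrobenioid.baseMap ψ = ModelFrobenioid.baseMap ψ := by
    intro g hg
    obtain ⟨γ, hγ, hγg⟩ := d.exists_mem_G_of_mem_galOver hg
    rw [← hγg, ← ModelFrobenioid.baseMap_comp, hGψ γ hγ]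
  have hz_inv : ∀ g ∈ S.galOver α,
      pull S.tf.divisorMonoid g.hom (ModelFrobenioid.div ψ) = ModelFrobenioid.div ψ := by
    intro g hg
    obtain ⟨γ, hγ, hγg⟩ := d.exists_mem_G_of_mem_galOver hg
    have h := congrArg ModelFrobenioid.div (hGψ γ hγ)
    rw [ModelFrobenioid.div_comp_pull, ModelFrobenioid.div_eq_one_of_isIso hΦd γ.hom, one_pow, mul_one,
      hγg] at h
    exact h
  -- the units of `α`, `ψ` as units of the group-like monoid `B(A_D)`
  obtain ⟨uα, huα⟩ := (hBg A.base).isUnit (ModelFrobenioid.unit α)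
  obtain ⟨uψ, huψ⟩ := (hBg A.base).isUnit (ModelFrobenioid.unit ψ)
  -- the `Gal`-invariant element `t := u_ψ · u_α^{-d'}`
  set t : S.tf.ratFnFunctor.obj (op A.base) := ((uψ * (uα ^ (d' : ℕ))⁻¹ : (S.tf.ratFnFunctor.obj (op A.base))ˣ) :
    S.tf.ratFnFunctor.obj (op A.base)) with ht
  have ht_val : t * ModelFrobenioid.unit α ^ (d' : ℕ) = ModelFrobenioid.unit ψ := by
    rw [ht, ← huψ, ← huα, ← Units.val_pow_eq_pow_val, ← Units.val_mul, inv_mul_cancel_right]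
  have ht_inv : ∀ g ∈ S.galOver α, pull S.tf.ratFnFunctor g.hom t = t := by
    intro g hg
    obtain ⟨γ, hγ, hγg⟩ := d.exists_mem_G_of_mem_galOver hg
    obtain ⟨uγ, huγ⟩ := (hBg A.base).isUnit (ModelFrobenioid.unit γ.hom)
    have hψu := congrArg ModelFrobenioid.unit (hGψ γ hγ)
    have hαu := congrArg ModelFrobenioid.unit (hGα γ hγ)
    rw [ModelFrobenioid.unit_comp_pull, hγg] at hψu hαu
    -- in the unit group: `g^* uψ · uγ^{deg ψ} = uψ`, `g^* uα · uγ^{N} = uα`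
    let P : (S.tf.ratFnFunctor.obj (op A.base))ˣ →* (S.tf.ratFnFunctor.obj (op A.base))ˣ :=
      Units.map (pull S.tf.ratFnFunctor g.hom)
    have hPψ : P uψ = uψ * (uγ ^ (ModelFrobenioid.degFr ψ : ℕ))⁻¹ := by
      rw [eq_mul_inv_iff_mul_eq]
      exact Units.ext (by
        rw [Units.val_mul, Units.val_pow_eq_pow_val, Units.coe_map, huγ, huψ]; exact hψu)
    have hPα : P uα = uα * (uγ ^ (N : ℕ))⁻¹ := by
      rw [eq_mul_inv_iff_mul_eq]
      exact Units.ext (by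
        rw [Units.val_mul, Units.val_pow_eq_pow_val, Units.coe_map, huγ, huα]; exact hαu)
    have key : P (uψ * (uα ^ (d' : ℕ))⁻¹) = uψ * (uα ^ (d' : ℕ))⁻¹ := by
      rw [map_mul, map_inv, map_pow, hPψ, hPα, mul_pow, inv_pow, hd', PNat.mul_coe, pow_mul]
      exact units_aux _ _ _
    have hv := congrArg Units.val key
    rw [Units.coe_map] at hv
    exact hv
  -- the descended components
  obtain ⟨q', hq'⟩ := hQ (ModelFrobenioid.baseMap ψ) hq_inv
  obtain ⟨z', hz'⟩ := hΦ (ModelFrobenioid.div ψ) hz_inv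
  obtain ⟨t', ht'⟩ := hB t ht_inv
  -- the relation (d) for `ψ' := (d', q', z', t')`, checked after the injective pull-back along `p`
  have hrelα := ModelFrobenioid.rel α
  rw [hdivα, map_one, mul_one] at hrelα
  have hrelψ := ModelFrobenioid.rel ψ
  rw [hd', PNat.mul_coe, ← ht_val, map_mul, map_pow] at hrelψ
  have hrel' : B.cls ^ (d' : ℕ) * Algebra.GrothendieckGroup.of z' =
      pullGp S.tf.divisorMonoid q' Y.cls *
        divB S.tf.divisorMonoid S.tf.ratFnFunctor S.tf.divBNatTrans (op B.base) t' := by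
    apply hΦinj
    rw [map_mul, map_mul, map_pow, pullGp_of, ← pullGp_comp, hq', pullGp_divB]
    change _ * Algebra.GrothendieckGroup.of (pull S.tf.divisorMonoid p z') =
      _ * divB _ _ _ _ (pull S.tf.ratFnFunctor p t')
    rw [hz', ht']
    -- `p^* β = a^N · Div_B(u_α)⁻¹`
    have hβ : pullGp S.tf.divisorMonoid p B.cls =
        A.cls ^ (N : ℕ) * (divB S.tf.divisorMonoid S.tf.ratFnFunctor S.tf.divBNatTrans (op A.base)
          (ModelFrobenioid.unit α))⁻¹ :=
      eq_mul_inv_of_mul_eq hrelα.symm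
    rw [hβ]
    calc (A.cls ^ (N : ℕ) * (divB S.tf.divisorMonoid S.tf.ratFnFunctor S.tf.divBNatTrans (op A.base)
            (ModelFrobenioid.unit α))⁻¹) ^ (d' : ℕ) * Algebra.GrothendieckGroup.of (ModelFrobenioid.div ψ)
        = A.cls ^ ((N : ℕ) * (d' : ℕ)) * Algebra.GrothendieckGroup.of (ModelFrobenioid.div ψ) *
            (divB S.tf.divisorMonoid S.tf.ratFnFunctor S.tf.divBNatTrans (op A.base)
              (ModelFrobenioid.unit α) ^ (d' : ℕ))⁻¹ := by
          rw [mul_pow, ← pow_mul, inv_pow, mul_right_comm]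
      _ = pullGp S.tf.divisorMonoid (ModelFrobenioid.baseMap ψ) Y.cls *
            (divB S.tf.divisorMonoid S.tf.ratFnFunctor S.tf.divBNatTrans (op A.base) t *
              divB S.tf.divisorMonoid S.tf.ratFnFunctor S.tf.divBNatTrans (op A.base)
                (ModelFrobenioid.unit α) ^ (d' : ℕ)) *
            (divB S.tf.divisorMonoid S.tf.ratFnFunctor S.tf.divBNatTrans (op A.base)
              (ModelFrobenioid.unit α) ^ (d' : ℕ))⁻¹ := by rw [hrelψ]
      _ = pullGp S.tf.divisorMonoid (ModelFrobenioid.baseMap ψ) Y.cls *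
            divB S.tf.divisorMonoid S.tf.ratFnFunctor S.tf.divBNatTrans (op A.base) t := by
          rw [mul_assoc, mul_assoc, mul_inv_cancel, mul_one]
  -- the morphism `ψ'`
  let ψ' : B ⟶ Y := ModelFrobenioid.mkHom B Y d' q' z' t' hrel'
  have hfac : α ≫ ψ' = ψ := by
    apply ModelFrobenioid.hom_ext
    · rw [ModelFrobenioid.degFr_comp, hd']
      exact mul_comm _ _
    · rw [ModelFrobenioid.baseMap_comp]
      exact hq'
    · rw [ModelFrobenioid.div_comp_pull, hdivα, one_pow, mul_one]
      exact hz'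
    · rw [ModelFrobenioid.unit_comp_pull]
      change pull S.tf.ratFnFunctor p t' * ModelFrobenioid.unit α ^ (d' : ℕ) = _
      rw [ht', ht_val]
  refine ⟨ψ', hfac, fun ψ'' hψ'' => ?_⟩
  -- uniqueness, component by component
  have hdeg : ModelFrobenioid.degFr ψ'' = d' := by
    have h := congrArg ModelFrobenioid.degFr hψ''
    rw [ModelFrobenioid.degFr_comp, hd'] at h
    exact mul_right_cancel (h.trans (mul_comm _ _))
  apply ModelFrobenioid.hom_ext
  · rw [hdeg]
    rfl
  · -- `Base`: `p` is an epimorphism of `D` (totally epimorphic base)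
    haveI := S.tf.isTotallyEpimorphic.epi p
    have h := congrArg ModelFrobenioid.baseMap hψ''
    rw [ModelFrobenioid.baseMap_comp] at h
    change p ≫ _ = _ at h
    rw [← hq'] at h
    exact (cancel_epi p).1 h
  · -- `Div`: injectivity of `p^*` on `Φ(B_D)` (from `Φ(B_D)^gp`, `Φ` integral)
    have h := congrArg ModelFrobenioid.div hψ''
    rw [ModelFrobenioid.div_comp_pull, hdivα, one_pow, mul_one] at h
    change pull S.tf.divisorMonoid p (ModelFrobenioid.div ψ'') = _ at h
    rw [← hz'] at h
    apply (hΦd B.base).isPreDivisorial.isIntegral.injective_of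
    apply hΦinj
    rw [pullGp_of, pullGp_of]
    exact congrArg Algebra.GrothendieckGroup.of h
  · -- `u`: injectivity of `p^*` on `B(B_D)`
    have h := congrArg ModelFrobenioid.unit hψ''
    rw [ModelFrobenioid.unit_comp_pull, hdeg] at h
    change pull S.tf.ratFnFunctor p (ModelFrobenioid.unit ψ'') * _ = _ at h
    rw [← ht_val, ← ht'] at h
    exact hBinj (mul_right_cancel h)

/-- **Remark 4.1.1, second clause, when `Base(α)` is an isomorphism** (e.g. `α = α''` a Frobenius endomorphism, or
any setting over a base all of whose arrows are invertible): the descent inputs (Q), (Φ), (B) are automatic, so every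
`ψ : A → Y` over which `G · μ_N(A)` acts trivially factors uniquely through `α` (`Φ` divisorial, `B` group-like).
[cite: MochizukiEtTh2009, Rmk 4.1.1 p.88] -/
theorem existsUnique_fac_of_isIso_baseMap (d : S.BaseFrobeniusTypeData α)
    (hΦd : Objectwise (fun M _ => IsDivisorial M) S.tf.divisorMonoid)
    (hBg : Objectwise (fun M _ => IsGroupLike M) S.tf.ratFnFunctor) [IsIso (ModelFrobenioid.baseMap α)]
    {Y : S.C} (ψ : A ⟶ Y) (hψ : ∀ γ ∈ d.G ⊔ Subgroup.closure (S.mu A (S.degFr α)), γ.hom ≫ ψ = ψ) :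
    ∃! ψ' : B ⟶ Y, α ≫ ψ' = ψ := by
  have hsec : ∀ (Ψ : Dᵒᵖ ⥤ CommMonCat.{w}) (x : Ψ.obj (op A.base)),
      pull Ψ (ModelFrobenioid.baseMap α) (pull Ψ (inv (ModelFrobenioid.baseMap α)) x) = x := fun Ψ x => by
    rw [← pull_comp, IsIso.hom_inv_id, pull_id]
  have hinj : ∀ (Ψ : Dᵒᵖ ⥤ CommMonCat.{w}), Function.Injective (pull Ψ (ModelFrobenioid.baseMap α)) :=
    fun Ψ x y hxy => by
      have h := congrArg (pull Ψ (inv (ModelFrobenioid.baseMap α))) hxy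
      rwa [← pull_comp, ← pull_comp, IsIso.inv_hom_id, pull_id, pull_id] at h
  refine d.existsUnique_fac_of_descent hΦd hBg (fun q _ => ⟨inv (ModelFrobenioid.baseMap α) ≫ q, by simp⟩)
    (fun z _ => ⟨pull _ (inv (ModelFrobenioid.baseMap α)) z, hsec _ z⟩) ?_
    (fun t _ => ⟨pull _ (inv (ModelFrobenioid.baseMap α)) t, hsec _ t⟩) (hinj _) ψ hψ
  -- injectivity on `Φ(B_D)^gp`: `pullGp` along an isomorphism has a left inverse
  intro x y hxy
  have h := congrArg (pullGp S.tf.divisorMonoid (inv (ModelFrobenioid.baseMap α))) hxy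
  rwa [← pullGp_comp, ← pullGp_comp, IsIso.inv_hom_id, pullGp_id, pullGp_id] at h

end BaseFrobeniusTypeData

/-- **Remark 4.1.1 (both clauses) for a setting over a base category all of whose arrows are invertible**
(`Φ` divisorial, `B` group-like): then every morphism of base-Frobenius type is a categorical quotient of its domain
by `G · μ_N(A)` — among ALL objects, in particular among the Frobenius-trivial ones.  (Instance form of the named
fact `Remark411`; the complementary span-base countermodel is `not_forall_remark411`.)
[cite: MochizukiEtTh2009, Rmk 4.1.1 p.88] -/
theorem remark411_of_forall_isIso (hΦd : Objectwise (fun M _ => IsDivisorial M) S.tf.divisorMonoid)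
    (hBg : Objectwise (fun M _ => IsGroupLike M) S.tf.ratFnFunctor)
    (hD : ∀ {Y₀ Z₀ : D} (f : Y₀ ⟶ Z₀), IsIso f) : S.Remark411 := by
  intro A B α d
  refine ⟨S.remark411_actsOver hΦd α d, fun Y _ ψ hψ => ?_⟩
  haveI := hD (ModelFrobenioid.baseMap α)
  exact d.existsUnique_fac_of_isIso_baseMap hΦd hBg ψ hψ

end BiKummerSetting


end Literature.AnabelianGeometry.EtaleTheta

end
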